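import Summits.NavierStokesRegularity.NavierStokesRegularity.Theorems.ScenarioCensusRowD9SteadyLimitTools
import HarnessLib

/-!
# Census row D9 TYPED — part 9/9: §6e second half (`tendsto_iSup_eLpNorm_modRescale_sub`, the very weak steady limit,
# `modulatedSteadyLimit_holds'` = S0 PROVED); §7 the UNCONDITIONAL theorems of the line (`row_D9LH_iff_wild'`,
# `modulatedRateGate'`, `row_D9Sharp'`, `rateGate'`); the census KEYS `ScenarioCensus.Row_D9K` / `Row_D9LH`

Re-homed for the scenario census (typer seat ns-census-typer-1 g7; in scope of the census KEY text «one `def Row_<k> : Prop`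
per OPEN row» — row D9 was the one OPEN-NO-LINE row without a typed tree decl, typer-1 g6 HANDOFF 19:50Z; lead programme ended
at v1.67, base SUMMON-only; ANNOUNCE on the cell STATUS 2026-08-28T20:24Z): VERBATIM PORT of ns-idea-9 LINE 16 «modulation_gate»
rev 5, `pub/ideators/ns-idea-9/lines/modulation_gate/modulation_gate.lean` sha16 1d7b2cd493e504e0 (2259 l., lean check rc 0,
0 sorry; critic idea-crit-8 V66/V67/V69 PASS-WITH-PRICE on rev 1–4, ref ns-census-ref g8 PRE-CHECK ✓ §13.14 [5/6] of rev 4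
f704279be2039922; rev 5 = rev 4 + §6e «S0 proved»; TARGET-MENU r4 names this line as row D9's lever; CENSUS-FINAL r6 §2 lists
`row_F4bp_of_row_D9K` / `row_F4bpLH_of_row_D9LH` as FILES-ONLY edges), split for the 400-line rule into
`ScenarioCensusRowD9Modulation` (§1–§4) → `…RowD9Kernel` (§5) → `…RowD9PowerLaw` (§6) → `…RowD9CoreExponents` (§6c (i)–(iv)) →
`…RowD9Core` (§6c (v)) → `…RowD9DissipationTools` (§6d, first half) → `…RowD9Dissipation` (§6d, second half) →
`…RowD9SteadyLimitTools` (§6e, first half) → `…RowD9` (§6e, second half; §7; census KEYS).  Lean text VERBATIM in namespace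
`…Theorems.ScenarioCensus.ModulationGate` (the line's `…Cruxes.Row_F4bp.ModulationGate` re-homed); port edits: the two
`local notation "E3"` lines → `abbrev E3` (typer lint: no notation in port files), `@[conjecture]` added to the four OPEN
parameterless `def`s `Row_D9K` / `Row_D9LH` / `Row_D9LHWild` / `Row_F4bpLH` (obligation nodes), one-line docstrings added to twelve undocumented auxiliaries, the three
`@[deprecated] stub_*` aliases of §7 not re-declared, four §7 docstrings updated to the rev-5 facts (everything proved); the two VERBATIM
re-statements of `CoreProof.eLpNorm_zoom` inside `DissipationProof` / `SteadyLimitProof` are not re-declared (gate lint `dedup.landed`) — their two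
uses name `CoreProof.eLpNorm_zoom` (proof-only diffs); likewise §7's alias `steadyZoomDistance_holds` of the CORE is not re-declared — its
three uses name `CoreProof.steadyZoomDistance_proof`.

No census value is asserted here (a summoned lead books row D9; FILES-ONLY edges become TREE by name); NS regularity is NOT
proved; rows D9 / F4b′ stay OPEN (= their wild residuals, by theorem); no summit statement is proved by this file.
-/

-- the summit and its single problem share the name `NavierStokesRegularity` (D-0017 nested layout)
set_option linter.dupNamespace false

noncomputable section

open Set Function Filter Topology MeasureTheory Metric
open scoped NNReal ENNReal ContDiff

namespace Summit.NavierStokesRegularity.NavierStokesRegularity.Theorems.ScenarioCensus.ModulationGate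

open Literature.Analysis Literature.Analysis.FluidPDE
open Summit.NavierStokesRegularity.NavierStokesRegularity.Theorems.ScenarioCensus

namespace SteadyLimitProof

open TopologicalSpace
open scoped RealInnerProductSpace Laplacian
open Literature.Analysis.FunctionSpaces

/-- **(S0-g) UNIFORM CONVERGENCE OF THE MODULATED RESCALINGS ON THE UNIT WINDOW**: for a classical
solution on `(0,T)`, a stationary modulation `λ`, `p ∈ [1,∞)`, `V̄ ∈ L^p` with
`modulatedDeviation λ p v V̄ → 0`, the rescalings `w_{t₀}(s,y) = c v(t₀ + c²s, cy)`, `c = λ(t₀)⁻¹`,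
satisfy `sup_{−1<s<0}‖w_{t₀}(s) − V̄‖_p → 0` as `t₀ ↑ T` (mean value theorem on the window of
length `μ(t₀) = c²` + strong continuity of dilations). -/
theorem tendsto_iSup_eLpNorm_modRescale_sub {T : ℝ} {p : ℝ≥0} {v : ℝ → E3 → E3} {π : ℝ → E3 → ℝ}
    {V : E3 → E3} {lam : ℝ → ℝ} (hT : 0 < T)
    (hv : IsClassicalNSSolutionOn (Ioo 0 T) 1 0 v π) (hmod : IsStationaryModulation T lam)
    (hp1 : 1 ≤ p) (hV : MemLp V (p : ℝ≥0∞) volume)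
    (hconv : Tendsto (modulatedDeviation lam p v V) (𝓝[<] T) (𝓝 0)) :
    Tendsto (fun t₀ : ℝ => ⨆ s ∈ Ioo (-1 : ℝ) 0, eLpNorm
      (fun y => FluidPDE.nsRescale ((lam t₀)⁻¹) (fun τ x => v (t₀ + τ) x) s y - V y)
      (p : ℝ≥0∞) volume) (𝓝[<] T) (𝓝 0) := by
  rw [ENNReal.tendsto_nhds_zero]
  intro ε hε
  rcases eq_or_ne ε ∞ with hεtop | hεtop
  · exact Eventually.of_forall fun _ => hεtop ▸ le_top
  set η : ℝ≥0∞ := ε / 8 with hη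
  have hη0 : 0 < η := ENNReal.div_pos hε.ne' (by norm_num)
  have h4η0 : 0 < 4 * η := ENNReal.mul_pos (by norm_num) hη0.ne'
  -- (i) the deviation is `≤ η` on a window `(T₁, T)`
  obtain ⟨T₁, hT₁T, hdevT₁⟩ : ∃ T₁ < T, Ioo T₁ T ⊆ {t | modulatedDeviation lam p v V t ≤ η} :=
    mem_nhdsLT_iff_exists_Ioo_subset.1 (ENNReal.tendsto_nhds_zero.1 hconv _ hη0)
  -- (ii) dilation continuity: `‖D_μ V − V‖_p ≤ 4η` for `|μ − 1| < δ₂ ≤ ½`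
  obtain ⟨δ₂, hδ₂, hδ₂h, hdil⟩ : ∃ δ₂ > 0, δ₂ ≤ 1 / 2 ∧ ∀ μ : ℝ, dist μ 1 < δ₂ →
      eLpNorm (nsRescaleData μ V - V) (p : ℝ≥0∞) volume ≤ 4 * η := by
    have h := ENNReal.tendsto_nhds_zero.1 (tendsto_eLpNorm_nsRescaleData_sub_self
      (E := E3) (by exact_mod_cast hp1) ENNReal.coe_ne_top hV) _ h4η0
    obtain ⟨δ, hδ, hball⟩ := Metric.eventually_nhds_iff.1 h
    exact ⟨min δ (1 / 2), lt_min hδ (by norm_num), min_le_right _ _,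
      fun μ hμ => hball (lt_of_lt_of_le hμ (min_le_left _ _))⟩
  -- (iii) stationarity: `|μ′| ≤ κ := δ₂/4` and differentiability on `(T₄, T)`
  obtain ⟨μ', hder, hμ'⟩ := hmod.stationary
  set κ : ℝ := δ₂ / 4 with hκ
  have hκ0 : 0 < κ := by positivity
  have hsmall : ∀ᶠ t in 𝓝[<] T, dist (μ' t) 0 < κ := hμ'.eventually (Metric.ball_mem_nhds 0 hκ0)
  obtain ⟨T₄, hT₄T, hT₄⟩ : ∃ T₄ < T, Ioo T₄ T ⊆
      {t | HasDerivAt (fun s => ((lam s) ^ 2)⁻¹) (μ' t) t ∧ dist (μ' t) 0 < κ} :=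
    mem_nhdsLT_iff_exists_Ioo_subset.1 (hder.and hsmall)
  -- (iv) positivity of `λ` on `(T₃, T)`
  obtain ⟨T₃, hT₃T, hT₃⟩ : ∃ T₃ < T, Ioo T₃ T ⊆ {t | 0 < lam t} :=
    mem_nhdsLT_iff_exists_Ioo_subset.1 (hmod.tendsto_atTop.eventually (eventually_gt_atTop 0))
  -- (v) good base times: the whole window `(t₀ − c², t₀)` lies in `(L, T)`
  obtain ⟨L, hLT, hL1, hL3, hL4, hL0⟩ : ∃ L < T, T₁ ≤ L ∧ T₃ ≤ L ∧ T₄ ≤ L ∧ 0 ≤ L :=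
    ⟨max (max T₁ T₃) (max T₄ 0), max_lt (max_lt hT₁T hT₃T) (max_lt hT₄T hT),
      le_trans (le_max_left _ _) (le_max_left _ _), le_trans (le_max_right _ _) (le_max_left _ _),
      le_trans (le_max_left _ _) (le_max_right _ _), le_trans (le_max_right _ _) (le_max_right _ _)⟩
  have hm := tendsto_inv_sq_of_tendsto_atTop hmod.tendsto_atTop
  have hdiff : Tendsto (fun t₀ => t₀ - ((lam t₀) ^ 2)⁻¹) (𝓝[<] T) (𝓝 (T - 0)) :=
    (tendsto_nhdsWithin_of_tendsto_nhds tendsto_id).sub hm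
  have hLT' : L < T - 0 := by rw [sub_zero]; exact hLT
  have hwinL : ∀ᶠ t₀ in 𝓝[<] T, L < t₀ - ((lam t₀) ^ 2)⁻¹ := hdiff.eventually (lt_mem_nhds hLT')
  filter_upwards [eventually_window hT hmod.tendsto_atTop, hwinL] with t₀ hgood hwinL
  obtain ⟨hc0, hct₀, ht₀T⟩ := hgood
  refine iSup₂_le fun s hs => ?_
  -- the window and the time `t`
  have hl0 : 0 < lam t₀ := inv_pos.1 hc0
  have hc2 : ((lam t₀)⁻¹) ^ 2 = ((lam t₀) ^ 2)⁻¹ := by rw [inv_pow]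
  have hc20 : 0 < ((lam t₀)⁻¹) ^ 2 := by positivity
  obtain ⟨ht_lt, ht_gt, hwin_len⟩ := window_arith (t₀ := t₀) hc20 hs
  have htL : L < t₀ + ((lam t₀)⁻¹) ^ 2 * s := by rw [hc2] at ht_gt; linarith
  have htT : t₀ + ((lam t₀)⁻¹) ^ 2 * s < T := ht_lt.trans ht₀T
  have ht0 : 0 < t₀ + ((lam t₀)⁻¹) ^ 2 * s := lt_of_le_of_lt hL0 htL
  have htT₁ : T₁ < t₀ + ((lam t₀)⁻¹) ^ 2 * s := lt_of_le_of_lt hL1 htL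
  have htT₃ : T₃ < t₀ + ((lam t₀)⁻¹) ^ 2 * s := lt_of_le_of_lt hL3 htL
  have htT₄ : T₄ < t₀ + ((lam t₀)⁻¹) ^ 2 * s := lt_of_le_of_lt hL4 htL
  have hlt : 0 < lam (t₀ + ((lam t₀)⁻¹) ^ 2 * s) := hT₃ ⟨htT₃, htT⟩
  have hdev_t : modulatedDeviation lam p v V (t₀ + ((lam t₀)⁻¹) ^ 2 * s) ≤ η := hdevT₁ ⟨htT₁, htT⟩
  -- mean value theorem on `[t, t₀]`: `|μ(t₀) − μ(t)| ≤ κ (t₀ − t) ≤ κ c²`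
  have hIcc : Icc (t₀ + ((lam t₀)⁻¹) ^ 2 * s) t₀ ⊆ Ioo T₄ T :=
    fun x hx => ⟨lt_of_lt_of_le htT₄ hx.1, lt_of_le_of_lt hx.2 ht₀T⟩
  have hMVT : ‖((lam t₀) ^ 2)⁻¹ - ((lam (t₀ + ((lam t₀)⁻¹) ^ 2 * s)) ^ 2)⁻¹‖ ≤
      κ * ‖t₀ - (t₀ + ((lam t₀)⁻¹) ^ 2 * s)‖ :=
    (convex_Icc (t₀ + ((lam t₀)⁻¹) ^ 2 * s) t₀).norm_image_sub_le_of_norm_hasDerivWithin_le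
      (f := fun s => ((lam s) ^ 2)⁻¹) (f' := μ')
      (fun x hx => ((hT₄ (hIcc hx)).1).hasDerivWithinAt)
      (fun x hx => by
        have h := (hT₄ (hIcc hx)).2
        rw [Real.dist_eq, sub_zero] at h
        exact h.le)
      (left_mem_Icc.2 ht_lt.le) (right_mem_Icc.2 ht_lt.le)
  rw [Real.norm_eq_abs, Real.norm_eq_abs, abs_of_nonneg (sub_nonneg.2 ht_lt.le)] at hMVT
  have hkey : |((lam t₀) ^ 2)⁻¹ - ((lam (t₀ + ((lam t₀)⁻¹) ^ 2 * s)) ^ 2)⁻¹| ≤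
      κ * ((lam t₀) ^ 2)⁻¹ := by
    calc |((lam t₀) ^ 2)⁻¹ - ((lam (t₀ + ((lam t₀)⁻¹) ^ 2 * s)) ^ 2)⁻¹|
        ≤ κ * (t₀ - (t₀ + ((lam t₀)⁻¹) ^ 2 * s)) := hMVT
      _ ≤ κ * ((lam t₀)⁻¹) ^ 2 := mul_le_mul_of_nonneg_left hwin_len hκ0.le
      _ = κ * ((lam t₀) ^ 2)⁻¹ := by rw [hc2]
  -- the dilation parameter `μ = cλ(t)`; `μ² · λ(t)⁻² = λ(t₀)⁻²`
  have hμ0 : 0 < (lam t₀)⁻¹ * lam (t₀ + ((lam t₀)⁻¹) ^ 2 * s) := mul_pos hc0 hlt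
  have hmt_pos : 0 < ((lam (t₀ + ((lam t₀)⁻¹) ^ 2 * s)) ^ 2)⁻¹ := by positivity
  have hμsq : ((lam t₀)⁻¹ * lam (t₀ + ((lam t₀)⁻¹) ^ 2 * s)) ^ 2 *
      ((lam (t₀ + ((lam t₀)⁻¹) ^ 2 * s)) ^ 2)⁻¹ = ((lam t₀) ^ 2)⁻¹ :=
    ratio_sq_identity hl0.ne' hlt.ne'
  have hκh : κ ≤ 1 / 8 := by rw [hκ]; linarith
  have hB := abs_sq_sub_one_le hmt_pos hkey hμsq
  have hμ1 := abs_sub_one_le hμ0 hκ0.le hκh hB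
  have hμ_dist : dist ((lam t₀)⁻¹ * lam (t₀ + ((lam t₀)⁻¹) ^ 2 * s)) 1 < δ₂ := by
    rw [Real.dist_eq]; linarith
  have hμ_half : 1 / 2 ≤ (lam t₀)⁻¹ * lam (t₀ + ((lam t₀)⁻¹) ^ 2 * s) ∧
      (lam t₀)⁻¹ * lam (t₀ + ((lam t₀)⁻¹) ^ 2 * s) ≤ 2 := by
    have : |(lam t₀)⁻¹ * lam (t₀ + ((lam t₀)⁻¹) ^ 2 * s) - 1| < 1 / 2 :=
      lt_of_lt_of_le (by rwa [Real.dist_eq] at hμ_dist) hδ₂h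
    rw [abs_lt] at this
    constructor <;> linarith
  -- the Jacobian factor `μ^{1−3/p} ≤ 4`
  have hp1R : (1 : ℝ) ≤ (p : ℝ) := by exact_mod_cast hp1
  obtain ⟨he, he2⟩ := exponent_bounds hp1R
  have hJ : ENNReal.ofReal (((lam t₀)⁻¹ * lam (t₀ + ((lam t₀)⁻¹) ^ 2 * s)) ^ (1 - 3 / (p : ℝ))) ≤ 4 := by
    have h4 : ENNReal.ofReal (4 : ℝ) = 4 := by norm_num
    exact (ENNReal.ofReal_le_ofReal (rpow_le_four hμ_half.1 hμ_half.2 he he2)).trans_eq h4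
  -- assemble
  calc eLpNorm (fun y => FluidPDE.nsRescale ((lam t₀)⁻¹) (fun τ x => v (t₀ + τ) x) s y - V y)
        (p : ℝ≥0∞) volume
      ≤ ENNReal.ofReal (((lam t₀)⁻¹ * lam (t₀ + ((lam t₀)⁻¹) ^ 2 * s)) ^ (1 - 3 / (p : ℝ))) *
            modulatedDeviation lam p v V (t₀ + ((lam t₀)⁻¹) ^ 2 * s) +
          eLpNorm (nsRescaleData ((lam t₀)⁻¹ * lam (t₀ + ((lam t₀)⁻¹) ^ 2 * s)) V - V)
            (p : ℝ≥0∞) volume :=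
        eLpNorm_slice_sub_le hv hp1 hV hc0 ht0 htT hlt
    _ ≤ 4 * η + 4 * η := add_le_add (mul_le_mul' hJ hdev_t) (hdil _ hμ_dist)
    _ = 8 * (ε / 8) := by rw [hη]; ring
    _ = ε := ENNReal.mul_div_cancel (by norm_num) (by norm_num)

/-- **(S0-h) the constant field `(s,y) ↦ V̄(y)` is very weak NS on the slab `(−1,0) × ℝ³`** (`p ≥ 2`). -/
theorem mod_profile_integral_veryWeak_const_eq_zero {T : ℝ} {p : ℝ≥0} {v : ℝ → E3 → E3}
    {π : ℝ → E3 → ℝ} {V : E3 → E3} {lam : ℝ → ℝ} (hT : 0 < T)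
    (hv : IsClassicalNSSolutionOn (Ioo 0 T) 1 0 v π) (hmod : IsStationaryModulation T lam)
    (hp2 : 2 ≤ p) (hV : MemLp V (p : ℝ≥0∞) volume)
    (hconv : Tendsto (modulatedDeviation lam p v V) (𝓝[<] T) (𝓝 0))
    {ψ : ℝ → E3 → E3}
    (hψ : IsSpaceTimeTestOn (slab E3 (Ioo (-1) 0) isOpen_Ioo) ψ)
    (hdivψ : ∀ t, VectorCalculus.IsDivFree (ψ t)) :
    ∫ t in Ioo (-1) 0, ∫ x, (⟪V x, timeDeriv ψ t x⟫ + ⟪V x, convect V (ψ t) x⟫ +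
        1 * ⟪V x, Δ (ψ t) x⟫) = 0 := by
  have hp1 : 1 ≤ p := le_trans one_le_two hp2
  have hp2' : (2 : ℝ≥0∞) ≤ (p : ℝ≥0∞) := by exact_mod_cast hp2
  have hgood := eventually_window hT hmod.tendsto_atTop
  have key := integral_veryWeak_eq_zero_of_tendsto (l := 𝓝[<] T) (ν := 1) (q := (p : ℝ≥0∞)) hp2'
    (w := fun t₀ => FluidPDE.nsRescale ((lam t₀)⁻¹) fun τ x => v (t₀ + τ) x)
    (U := fun _ => V) ?_ ?_ ?_ ?_ ?_ hψ hdivψ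
  · exact key
  · filter_upwards [hgood] with t₀ ht₀
    exact (hv.nsRescale_window ht₀.1 ht₀.2.1 ht₀.2.2.le).smooth_velocity.continuousOn
  · filter_upwards [hgood] with t₀ ht₀
    intro ψ' hψ' hdiv'
    exact (hv.nsRescale_window ht₀.1 ht₀.2.1 ht₀.2.2.le).integral_veryWeak_eq_zero hψ' hdiv'
  · exact fun t _ => hV.1
  · intro a b _ _ R
    refine ⟨(eLpNorm V (p : ℝ≥0∞) volume).toNNReal, fun t _ => ?_⟩
    rw [ENNReal.coe_toNNReal hV.2.ne]
    exact eLpNorm_mono_measure _ Measure.restrict_le_self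
  · intro R
    refine tendsto_of_tendsto_of_tendsto_of_le_of_le tendsto_const_nhds
      (tendsto_iSup_eLpNorm_modRescale_sub hT hv hmod hp1 hV hconv) (fun _ => bot_le)
      fun t₀ => ?_
    exact iSup₂_mono fun s _ => eLpNorm_mono_measure _ Measure.restrict_le_self

/-- **(S0-i) the profile is weakly divergence free** (`p ≥ 1`). -/
theorem mod_profile_isWeaklyDivFree {T : ℝ} {p : ℝ≥0} {v : ℝ → E3 → E3}
    {π : ℝ → E3 → ℝ} {V : E3 → E3} {lam : ℝ → ℝ} (hT : 0 < T)
    (hv : IsClassicalNSSolutionOn (Ioo 0 T) 1 0 v π) (hmod : IsStationaryModulation T lam)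
    (hp1 : 1 ≤ p) (hV : MemLp V (p : ℝ≥0∞) volume)
    (hconv : Tendsto (modulatedDeviation lam p v V) (𝓝[<] T) (𝓝 0)) :
    IsWeaklyDivFree V := by
  have hgood := eventually_window hT hmod.tendsto_atTop
  have hs : (-(1 / 2) : ℝ) ∈ Ioo (-1 : ℝ) 0 := by constructor <;> norm_num
  have hp1' : (1 : ℝ≥0∞) ≤ (p : ℝ≥0∞) := by exact_mod_cast hp1
  refine isWeaklyDivFree_of_tendsto_eLpNorm_sub (l := 𝓝[<] T) hp1'
    (w := fun t₀ => FluidPDE.nsRescale ((lam t₀)⁻¹) (fun τ x => v (t₀ + τ) x) (-(1 / 2)))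
    ?_ ?_ hV.1 (fun R => lt_of_le_of_lt (eLpNorm_mono_measure _ Measure.restrict_le_self) hV.2) ?_
  · filter_upwards [hgood] with t₀ ht₀
    exact (hv.nsRescale_window ht₀.1 ht₀.2.1 ht₀.2.2.le).isWeaklyDivFree_slice hs
  · filter_upwards [hgood] with t₀ ht₀
    exact ((hv.nsRescale_window ht₀.1 ht₀.2.1 ht₀.2.2.le).contDiff_velocity hs).continuous
      |>.aestronglyMeasurable
  · intro R
    refine tendsto_of_tendsto_of_tendsto_of_le_of_le tendsto_const_nhds
      (tendsto_iSup_eLpNorm_modRescale_sub hT hv hmod hp1 hV hconv) (fun _ => bot_le)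
      fun t₀ => (eLpNorm_mono_measure _ Measure.restrict_le_self).trans
        (le_iSup₂_of_le (-(1 / 2)) hs le_rfl)

/-- **(S0-j) the profile is a very weak STEADY solution** (`p ≥ 2`): weakly divergence free and
`∫ (⟪V̄,(V̄·∇)φ⟫ + ⟪V̄,Δφ⟫) = 0` for every divergence-free test field (tree `steady_veryWeak_of_const_slab`). -/
theorem mod_profile_veryWeak_steadyNS {T : ℝ} {p : ℝ≥0} {v : ℝ → E3 → E3}
    {π : ℝ → E3 → ℝ} {V : E3 → E3} {lam : ℝ → ℝ} (hT : 0 < T)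
    (hv : IsClassicalNSSolutionOn (Ioo 0 T) 1 0 v π) (hmod : IsStationaryModulation T lam)
    (hp2 : 2 ≤ p) (hV : MemLp V (p : ℝ≥0∞) volume)
    (hconv : Tendsto (modulatedDeviation lam p v V) (𝓝[<] T) (𝓝 0)) :
    IsWeaklyDivFree V ∧
      ∀ φ : E3 → E3, FunctionSpaces.IsTestFunctionOn (⊤ : Opens E3) φ →
        VectorCalculus.IsDivFree φ → ∫ x, (⟪V x, convect V φ x⟫ + ⟪V x, Δ φ x⟫) = 0 :=
  ⟨mod_profile_isWeaklyDivFree hT hv hmod (le_trans one_le_two hp2) hV hconv,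
    fun _ hφ hdivφ => steady_veryWeak_of_const_slab hp2 hV
      (fun _ hψ hdivψ =>
        mod_profile_integral_veryWeak_const_eq_zero hT hv hmod hp2 hV hconv hψ hdivψ) hφ hdivφ⟩

/-- **S0 `ModulatedSteadyLimit` — PROVED.** -/
theorem modulatedSteadyLimit_holds : ModulatedSteadyLimit := by
  intro T hT p hp3 v π hv lam hmod V hV hconv
  obtain ⟨hdiv, hsteady⟩ :=
    mod_profile_veryWeak_steadyNS hT hv hmod (le_trans (by norm_num) hp3.le) hV hconv
  exact exists_steadyClassicalNS_ae_eq_of_veryWeak hp3 hV hdiv hsteady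

end SteadyLimitProof

/-- **S0 `ModulatedSteadyLimit` — PROVED (rev 5; sorry-free).** -/
theorem modulatedSteadyLimit_holds' : ModulatedSteadyLimit := SteadyLimitProof.modulatedSteadyLimit_holds

/-! ## §7 (rev 5) NO STUBS LEFT: S0 (PROVED §6e), G1 (PROVED §6d), the CORE (PROVED §6c) and the theorem of
the line — UNCONDITIONAL.  (Port note: the line's three `@[deprecated]` aliases `stub_modulatedSteadyLimit`,
`stub_modulatedDissipationGate`, `stub_steadyZoomDistance` are not re-declared in the tree.) -/

-- `steadyZoomDistance_holds : SteadyZoomDistance` (the line's §7 name of the CORE) is the tree's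
-- `CoreProof.steadyZoomDistance_proof` (part 5) BY NAME — an alias theorem is refused by the gate lint `dedup.landed`.

/-- **G2, the modulated rate gate — UNCONDITIONAL** (rev 5: S0 and the CORE are proved). -/
theorem modulatedRateGate' : ModulatedRateGate :=
  modulatedRateGate_of_core modulatedSteadyLimit_holds' CoreProof.steadyZoomDistance_proof

/-- **Theorem of the line — UNCONDITIONAL (rev 5: S0, G1 and the CORE are proved): D9 in the LH frame ⟺ its wild residual.** -/
theorem row_D9LH_iff_wild' : Row_D9LH ↔ Row_D9LHWild :=
  row_D9LH_iff_wild modulatedSteadyLimit_holds' CoreProof.steadyZoomDistance_proof modulatedDissipationGate_holds'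

/-- **The rung — UNCONDITIONAL** (rev 5): `Row_D9Sharp` (3 < p ≤ 9/2, any profile-stationary modulation, any frame, no `Ḣ¹`). -/
theorem row_D9Sharp' : Row_D9Sharp := row_D9Sharp_of_S0 modulatedSteadyLimit_holds'

/-- **What remains of the two rows after the line**: the wild residual alone gives `Row_D9LH` and,
by name, LINE 15's `Row_F4bpLH` (unconditional reductions; rev 5). -/
theorem row_D9LH_of_wild' (hW : Row_D9LHWild) : Row_D9LH := row_D9LH_iff_wild'.2 hW

/-- … and, by name, LINE 15's `Row_F4bpLH`. -/
theorem row_F4bpLH_of_wild' (hW : Row_D9LHWild) : Row_F4bpLH :=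
  row_F4bpLH_of_row_D9LH (row_D9LH_of_wild' hW)

/-- **LINE 15's G2 `RateGate` — PROVED** (sorry-free: `rateGate_of_core` + the proved CORE; `RateGate` is
LINE 15's Prop byte-verbatim, so ONE port of §6c to the tree lands G2 for BOTH lines). -/
theorem rateGate' : RateGate := rateGate_of_core CoreProof.steadyZoomDistance_proof

end Summit.NavierStokesRegularity.NavierStokesRegularity.Theorems.ScenarioCensus.ModulationGate

namespace Summit.NavierStokesRegularity.NavierStokesRegularity.Theorems.ScenarioCensus

/-! ## Census KEYS (ns `…Theorems.ScenarioCensus`): row D9 typed in the tree, two frames; OPEN — nothing asserted -/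

/-- **Row D9, Kato frame** (census row D9 «generalized / log-modulated self-similar Type-II blow-up,
`λ(t)√(T−t) → ∞`», typed): `:= ModulationGate.Row_D9K` (definitional alias, `Iff.rfl`).  Contains row F4b′
(`ModulationGate.row_F4bp_of_row_D9K : Row_D9K → Row_F4bp`); its `3 < p ≤ 9/2` part is the THEOREM
`ModulationGate.row_D9Sharp'`.  OPEN (p > 9/2) — nothing asserted.
[cite: Chae2010, Thm 1.4 and arXiv:0711.1113 §2 (modulated transform)] -/
@[conjecture] def Row_D9K : Prop := ModulationGate.Row_D9K

/-- **Row D9, forward = Leray–Hopf frame** (typed): `:= ModulationGate.Row_D9LH` (definitional alias).  By the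
THEOREM `ModulationGate.row_D9LH_iff_wild'` it is EQUIVALENT to its wild residual `ModulationGate.Row_D9LHWild`
(`p > 9/2`, integrable modulation speed, untamed remainder, `V̄ ∈ Ḣ¹`); contains LINE 15's `ModulationGate.Row_F4bpLH`
(`ModulationGate.row_F4bpLH_of_row_D9LH`).  OPEN — nothing asserted.
[cite: Chae2010, Thm 1.4 and arXiv:0711.1113 §2 (modulated transform)] -/
@[conjecture] def Row_D9LH : Prop := ModulationGate.Row_D9LH

/-- The Kato-frame key is the line's row, definitionally. -/
theorem row_D9K_iff : Row_D9K ↔ ModulationGate.Row_D9K := Iff.rfl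

/-- The LH-frame key is the line's row, definitionally. -/
theorem row_D9LH_iff : Row_D9LH ↔ ModulationGate.Row_D9LH := Iff.rfl

/-- **Census reading of row D9 (LH frame) after the line**: the key is equivalent to the WILD residual (unconditional). -/
theorem row_D9LH_iff_row_D9LHWild : Row_D9LH ↔ ModulationGate.Row_D9LHWild :=
  ModulationGate.row_D9LH_iff_wild'

end Summit.NavierStokesRegularity.NavierStokesRegularity.Theorems.ScenarioCensus

end
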